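import Literature.NumberTheory.Sieve.HeathBrownCubicApproxUSum
import HarnessLib

/-!
# Heath-Brown's Lemma 3.7 from Lemma 7.1, VII: the `U`-bounds for `𝒜^(K)`

Pure-proof file (no definitions) in the deduction of **Lemma 3.7 from the corrected Lemma 7.1** of
D. R. Heath-Brown, *Primes represented by `x³ + 2y³`*, Acta Math. 186 (2001), 1–84, §7 pp. 42–47
(decomposition of **parity.S18**, `Literature.NumberTheory.Sieve.setOf_prime_cube_add_two_mul_cube_infinite`).

`U_sum_bound` (`HeathBrownCubicApproxUSum`) bounds `∑_n |U₁^(n) − Û^(n)|` for a general family by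
three family-dependent terms E1 (non-good chain indices), E3ii (Buchstab primes of degree `≥ 2` or
repeated norm), E4 (square-free defect) plus `O(τ M/log X)`. For `𝒜^(K)`:

* `E1_A_eq_zero`, `E3ii_A_eq_zero` — E1 = E3ii = 0 by Lemma 3.1 (a member of `𝒜^(K)` has only
  first-degree prime factors, of pairwise distinct norms);
* `exists_prime_sq_dvd_of_defect` — a square-free defect forces `p² ∣ x³ + 2y³` for a prime
  `X^τ ≤ p ≤ 5X^{1−τ/2}` (Lemma 3.1: a square-free ideal dividing a member has square-free norm, so
  the cofactor is divisible by `P²`);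
* `card_cubeRoots_modSq_le`, `card_filter_modEq_Ioc_le`, `card_boxPairs_sq_dvd_le`,
  `sum_card_boxPairs_sq_dvd_le` — elementary count: `−2` has `≤ 3` cube roots `mod p²` (`p ≥ 5`),
  so `#{(x, y) : p² ∣ x³ + 2y³} ≤ 3(ηX + 1)((ηX + 1)/p² + 1)`, summed over `p`;
* `card_chainTuples_dvd_le` — at most `2^{4/τ}` chain tuples divide a given member;
* `E4_A_le` — hence E4 `≤ 2^{4/τ}·3(ηX+1)((ηX+1)2X^{−τ} + 5X^{1−τ/2} + 1)`;
* `eventually_hbTau_pow_mul_log`, `A_final_absorb`, `U_A_sum_bound`, **`U_A_bounds`** — the three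
  `U`-conjuncts of Lemma 3.7 for `𝒜^(K)` (`∑_{3≤n≤n₀} |U^(n) − Û^(n)|`, `|U₁^(1) − Û^(1)|`,
  `|U₁^(2) − Û^(2)|`, each `≤ C ξτ^{-4} η²X²/log X`), from `HeathBrown2001_lemma_7_1_normWeighted`.
-/

noncomputable section

open Polynomial NumberField Finset Filter Topology Asymptotics
open scoped nonZeroDivisors

namespace Literature.NumberTheory.Sieve.CubicSieve

open LFunctions.CubeRootTwoField CubicPrimes
open Literature.NumberTheory.LFunctions (idealNormCount)

/-! ### Cube roots of `−2` modulo `p²` -/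

/-- For a prime `p ≥ 5` there are at most `3` residues `r mod p²` with `r³ ≡ −2 (mod p²)`:
two such residues congruent `mod p` are equal (`p² ∣ (r₂ − r₁)(r₁² + r₁r₂ + r₂²)`, the second factor
`≡ 3r₁² ≢ 0 (mod p)`), and `mod p` there are `≤ 3` cube roots. [folklore] -/
theorem card_cubeRoots_modSq_le {p : ℕ} (hp : p.Prime) (hp5 : 5 ≤ p) :
    #((range (p ^ 2)).filter (fun r : ℕ => ((p : ℤ) ^ 2) ∣ (r : ℤ) ^ 3 + 2)) ≤ 3 := by
  classical
  haveI := Fact.mk hp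
  have hpp : Prime (p : ℤ) := Nat.prime_iff_prime_int.mp hp
  set s := (range (p ^ 2)).filter (fun r : ℕ => ((p : ℤ) ^ 2) ∣ (r : ℤ) ^ 3 + 2) with hs
  have hp2 : ¬ (p : ℤ) ∣ 2 := by
    intro h
    have : p ∣ 2 := by exact_mod_cast h
    have := Nat.le_of_dvd two_pos this
    omega
  have hp3 : (3 : ZMod p) ≠ 0 := by
    intro h
    have h' : ((3 : ℕ) : ZMod p) = 0 := by exact_mod_cast h
    rw [ZMod.natCast_eq_zero_iff] at h'
    have := Nat.le_of_dvd (by norm_num) h'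
    omega
  -- members: `p ∤ r`
  have hmem : ∀ r ∈ s, ((p : ℤ) ^ 2) ∣ (r : ℤ) ^ 3 + 2 ∧ r < p ^ 2 ∧ ¬ (p : ℤ) ∣ r := by
    intro r hr
    obtain ⟨hr, hd⟩ := mem_filter.mp hr
    rw [mem_range] at hr
    refine ⟨hd, hr, fun h => hp2 ?_⟩
    have h3 : (p : ℤ) ∣ (r : ℤ) ^ 3 := dvd_pow h three_ne_zero
    have h1 : (p : ℤ) ∣ (r : ℤ) ^ 3 + 2 := (dvd_pow_self (p : ℤ) two_ne_zero).trans hd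
    have := dvd_sub h1 h3
    simpa using this
  -- map to the cube roots of `-2` in `ZMod p`
  have hmaps : ∀ r ∈ s, ((r : ZMod p)) ∈ (nthRoots 3 ((-2 : ℤ) : ZMod p)).toFinset := by
    intro r hr
    obtain ⟨hd, -, -⟩ := hmem r hr
    rw [Multiset.mem_toFinset, mem_nthRoots (by norm_num : 0 < 3)]
    have h1 : (p : ℤ) ∣ (r : ℤ) ^ 3 + 2 := (dvd_pow_self (p : ℤ) two_ne_zero).trans hd
    have h2 := (ZMod.intCast_zmod_eq_zero_iff_dvd _ p).mpr h1
    push_cast at h2 ⊢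
    linear_combination h2
  have hinj : Set.InjOn (fun r : ℕ => (r : ZMod p)) s := by
    intro r₁ h₁ r₂ h₂ heq
    obtain ⟨hd₁, hr₁, hpr₁⟩ := hmem r₁ h₁
    obtain ⟨hd₂, hr₂, -⟩ := hmem r₂ h₂
    simp only at heq
    -- `p ∤ u = r₁² + r₁ r₂ + r₂²`
    have hu : ¬ (p : ℤ) ∣ (r₁ : ℤ) ^ 2 + r₁ * r₂ + (r₂ : ℤ) ^ 2 := by
      intro h
      have h0 := (ZMod.intCast_zmod_eq_zero_iff_dvd _ p).mpr h
      push_cast at h0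
      rw [← heq] at h0
      have hr0 : (r₁ : ZMod p) ≠ 0 := by
        intro h'
        rw [ZMod.natCast_eq_zero_iff] at h'
        exact hpr₁ (by exact_mod_cast h')
      have : (3 : ZMod p) * (r₁ : ZMod p) ^ 2 = 0 := by linear_combination h0
      rcases mul_eq_zero.mp this with h3 | h3
      · exact hp3 h3
      · exact hr0 (pow_eq_zero_iff two_ne_zero |>.mp h3)
    have hdiff : ((p : ℤ) ^ 2) ∣ ((r₂ : ℤ) - r₁) * ((r₁ : ℤ) ^ 2 + r₁ * r₂ + (r₂ : ℤ) ^ 2) := by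
      have h := dvd_sub hd₂ hd₁
      have e : (r₂ : ℤ) ^ 3 + 2 - ((r₁ : ℤ) ^ 3 + 2) =
          ((r₂ : ℤ) - r₁) * ((r₁ : ℤ) ^ 2 + r₁ * r₂ + (r₂ : ℤ) ^ 2) := by ring
      rwa [e] at h
    have hcop : IsCoprime ((p : ℤ) ^ 2) ((r₁ : ℤ) ^ 2 + r₁ * r₂ + (r₂ : ℤ) ^ 2) :=
      (hpp.coprime_iff_not_dvd.mpr hu).pow_left
    have hpd : ((p : ℤ) ^ 2) ∣ (r₂ : ℤ) - r₁ := hcop.dvd_of_dvd_mul_right hdiff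
    have hr₁' : (r₁ : ℤ) < (p : ℤ) ^ 2 := by exact_mod_cast hr₁
    have hr₂' : (r₂ : ℤ) < (p : ℤ) ^ 2 := by exact_mod_cast hr₂
    rcases le_total r₁ r₂ with h | h
    · have h0 : (0 : ℤ) ≤ r₂ - r₁ := by
        have : (r₁ : ℤ) ≤ r₂ := by exact_mod_cast h
        linarith
      have hlt : (r₂ : ℤ) - r₁ < (p : ℤ) ^ 2 := by
        have : (0 : ℤ) ≤ r₁ := by positivity
        linarith
      have := Int.eq_zero_of_dvd_of_nonneg_of_lt h0 hlt hpd
      have : (r₁ : ℤ) = r₂ := by linarith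
      exact_mod_cast this
    · have hpd' : ((p : ℤ) ^ 2) ∣ (r₁ : ℤ) - r₂ := by
        have h' := dvd_neg.mpr hpd
        have e : -((r₂ : ℤ) - r₁) = (r₁ : ℤ) - r₂ := by ring
        rwa [e] at h'
      have h0 : (0 : ℤ) ≤ r₁ - r₂ := by
        have : (r₂ : ℤ) ≤ r₁ := by exact_mod_cast h
        linarith
      have hlt : (r₁ : ℤ) - r₂ < (p : ℤ) ^ 2 := by
        have : (0 : ℤ) ≤ r₂ := by positivity
        linarith
      have := Int.eq_zero_of_dvd_of_nonneg_of_lt h0 hlt hpd'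
      have : (r₁ : ℤ) = r₂ := by linarith
      exact_mod_cast this
  calc #s ≤ #((nthRoots 3 ((-2 : ℤ) : ZMod p)).toFinset) := card_le_card_of_injOn _ hmaps hinj
    _ ≤ Multiset.card (nthRoots 3 ((-2 : ℤ) : ZMod p)) := Multiset.toFinset_card_le _
    _ ≤ 3 := card_nthRoots 3 _

/-- A residue class `mod r` meets `(a, b]` in at most `(b − a)/r + 1` integers. [folklore] -/
theorem card_filter_modEq_Ioc_le (a b v : ℕ) {r : ℕ} (hr : 0 < r) :
    #{x ∈ Ioc a b | x ≡ v [MOD r]} ≤ (b - a) / r + 1 := by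
  classical
  set s := (Ioc a b).filter (fun x => x ≡ v [MOD r]) with hs
  rcases s.eq_empty_or_nonempty with h | h
  · rw [h, card_empty]; exact Nat.zero_le _
  · set m := s.min' h with hm
    have hm_mem : m ∈ s := min'_mem s h
    obtain ⟨hmI, hmv⟩ := mem_filter.mp hm_mem
    rw [mem_Ioc] at hmI
    have hsub : s ⊆ (range ((b - a) / r + 1)).image (fun k => m + k * r) := by
      intro x hx
      have hmx : m ≤ x := min'_le s x hx
      obtain ⟨hxI, hxv⟩ := mem_filter.mp hx
      rw [mem_Ioc] at hxI
      have hmod : m ≡ x [MOD r] := hmv.trans hxv.symm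
      have hdvd : r ∣ x - m := (Nat.modEq_iff_dvd' hmx).mp hmod
      obtain ⟨k, hk⟩ := hdvd
      rw [mem_image]
      refine ⟨k, ?_, ?_⟩
      · rw [mem_range, Nat.lt_add_one_iff]
        have h1 : k * r ≤ b - a := by
          rw [mul_comm, ← hk]; omega
        calc k = k * r / r := (Nat.mul_div_cancel k hr).symm
          _ ≤ (b - a) / r := Nat.div_le_div_right h1
      · rw [mul_comm, ← hk]; omega
    calc #s ≤ #((range ((b - a) / r + 1)).image (fun k => m + k * r)) := card_le_card hsub
      _ ≤ #(range ((b - a) / r + 1)) := card_image_le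
      _ = (b - a) / r + 1 := card_range _

/-- **Pairs in the box with `p² ∣ x³ + 2y³`.** For a prime `p ≥ 5` and `X, η > 0`:
`#{(x, y) ∈ 𝒜-box : p² ∣ x³ + 2y³} ≤ 3(ηX + 1)((ηX + 1)/p² + 1)` (for each `y`, `p ∤ y` and
`x ≡ r y (mod p²)` with `r` one of the `≤ 3` cube roots of `−2 mod p²`). [folklore] -/
theorem card_boxPairs_sq_dvd_le {X η : ℝ} (hX : 0 < X) (hη : 0 < η) {p : ℕ} (hp : p.Prime)
    (hp5 : 5 ≤ p) :
    (#{xy ∈ boxPairs X η | p ^ 2 ∣ xy.1 ^ 3 + 2 * xy.2 ^ 3} : ℝ) ≤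
      3 * (η * X + 1) * ((η * X + 1) / (p : ℝ) ^ 2 + 1) := by
  classical
  haveI : NeZero (p ^ 2) := ⟨pow_ne_zero 2 hp.ne_zero⟩
  have hp2pos : 0 < p ^ 2 := pow_pos hp.pos 2
  set a := ⌊X⌋₊ with ha
  set b := ⌊X * (1 + η)⌋₊ with hb
  set Y := Ioc a b with hY
  set Rt := (range (p ^ 2)).filter (fun r : ℕ => ((p : ℤ) ^ 2) ∣ (r : ℤ) ^ 3 + 2) with hRt
  set S := (boxPairs X η).filter (fun xy => p ^ 2 ∣ xy.1 ^ 3 + 2 * xy.2 ^ 3) with hS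
  -- the box in terms of `Y`
  have hmemY : ∀ {x : ℕ}, X < x → (x : ℝ) ≤ X * (1 + η) → x ∈ Y := by
    intro x h1 h2
    rw [hY, mem_Ioc, ha, hb]
    exact ⟨(Nat.floor_lt hX.le).mpr h1, Nat.le_floor h2⟩
  -- covering
  set T := (Rt ×ˢ Y).biUnion (fun ry => (Y.filter (fun x => x ≡ ry.1 * ry.2 [MOD p ^ 2])).map
    ⟨fun x => (x, ry.2), fun x₁ x₂ h => (Prod.ext_iff.mp h).1⟩) with hT
  have hcover : S ⊆ T := by
    rintro ⟨x, y⟩ hxy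
    rw [hS, mem_filter, mem_boxPairs_iff] at hxy
    obtain ⟨⟨hx1, hx2, hy1, hy2, hcop⟩, hdvd⟩ := hxy
    simp only at hx1 hx2 hy1 hy2 hcop hdvd
    -- `p ∤ y`
    have hpy : ¬ p ∣ y := by
      intro hpy'
      have h1 : p ∣ x ^ 3 + 2 * y ^ 3 := (dvd_pow_self p two_ne_zero).trans hdvd
      have h2 : p ∣ 2 * y ^ 3 := (hpy'.trans (dvd_pow_self y three_ne_zero)).mul_left 2
      have h3 : p ∣ x ^ 3 := (Nat.dvd_add_left h2).mp h1
      have h4 : p ∣ x := hp.dvd_of_dvd_pow h3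
      have h5 : p ∣ Nat.gcd x y := Nat.dvd_gcd h4 hpy'
      rw [hcop] at h5
      exact hp.one_lt.ne' (Nat.dvd_one.mp h5)
    have hcopy : Nat.Coprime y (p ^ 2) :=
      (Nat.Coprime.pow_right 2 ((Nat.Prime.coprime_iff_not_dvd hp).mpr hpy).symm)
    set u := ZMod.unitOfCoprime y hcopy with hu
    have hucoe : ((u : (ZMod (p ^ 2))ˣ) : ZMod (p ^ 2)) = (y : ZMod (p ^ 2)) := ZMod.coe_unitOfCoprime y hcopy
    set r : ℕ := ((x : ZMod (p ^ 2)) * ((u⁻¹ : (ZMod (p ^ 2))ˣ) : ZMod (p ^ 2))).val with hr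
    have hrlt : r < p ^ 2 := ZMod.val_lt _
    have hrcast : (r : ZMod (p ^ 2)) = (x : ZMod (p ^ 2)) * ((u⁻¹ : (ZMod (p ^ 2))ˣ) : ZMod (p ^ 2)) :=
      ZMod.natCast_zmod_val _
    have hmi : ((u : (ZMod (p ^ 2))ˣ) : ZMod (p ^ 2)) * ((u⁻¹ : (ZMod (p ^ 2))ˣ) : ZMod (p ^ 2)) = 1 :=
      Units.mul_inv u
    -- `x ≡ r y`
    have hxry : x ≡ r * y [MOD p ^ 2] := by
      rw [← ZMod.natCast_eq_natCast_iff]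
      push_cast
      rw [hrcast, ← hucoe]
      linear_combination -((x : ZMod (p ^ 2))) * hmi
    -- `r ∈ Rt`
    have hxy0 : ((x ^ 3 + 2 * y ^ 3 : ℕ) : ZMod (p ^ 2)) = 0 := (ZMod.natCast_eq_zero_iff _ _).mpr hdvd
    push_cast at hxy0
    have hrRt : r ∈ Rt := by
      rw [hRt, mem_filter, mem_range]
      refine ⟨hrlt, ?_⟩
      have hgoal : (((r : ℤ) ^ 3 + 2 : ℤ) : ZMod (p ^ 2)) = 0 := by
        push_cast
        rw [hrcast]
        rw [← hucoe] at hxy0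
        set w := ((u⁻¹ : (ZMod (p ^ 2))ˣ) : ZMod (p ^ 2))
        set uu := ((u : (ZMod (p ^ 2))ˣ) : ZMod (p ^ 2))
        linear_combination w ^ 3 * hxy0 - 2 * ((uu * w) ^ 2 + uu * w + 1) * hmi
      have := (ZMod.intCast_zmod_eq_zero_iff_dvd _ (p ^ 2)).mp hgoal
      push_cast at this
      exact this
    -- conclude
    rw [hT, mem_biUnion]
    refine ⟨(r, y), mem_product.mpr ⟨hrRt, hmemY hy1 hy2⟩, ?_⟩
    rw [Finset.mem_map]
    exact ⟨x, mem_filter.mpr ⟨hmemY hx1 hx2, hxry⟩, rfl⟩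
  -- sizes
  have hab : a ≤ b := Nat.floor_le_floor (by nlinarith)
  have hYcard : (#Y : ℝ) ≤ η * X + 1 := by
    rw [hY, Nat.card_Ioc, Nat.cast_sub hab]
    have h1 : (b : ℝ) ≤ X * (1 + η) := Nat.floor_le (by positivity)
    have h2 : X - 1 < (a : ℝ) := by
      have := Nat.lt_floor_add_one X; rw [← ha] at this; linarith
    linarith
  have hba : ((b - a : ℕ) : ℝ) ≤ η * X + 1 := by
    have : ((b - a : ℕ) : ℝ) = #Y := by rw [hY, Nat.card_Ioc]
    rw [this]; exact hYcard
  have hRt3 : #Rt ≤ 3 := card_cubeRoots_modSq_le hp hp5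
  have hfib : ∀ ry ∈ Rt ×ˢ Y, (#((Y.filter (fun x => x ≡ ry.1 * ry.2 [MOD p ^ 2])).map
      ⟨fun x => (x, ry.2), fun x₁ x₂ h => (Prod.ext_iff.mp h).1⟩) : ℝ) ≤ (η * X + 1) / (p : ℝ) ^ 2 + 1 := by
    intro ry _
    rw [card_map]
    have h := card_filter_modEq_Ioc_le a b (ry.1 * ry.2) hp2pos
    calc (#((Ioc a b).filter (fun x => x ≡ ry.1 * ry.2 [MOD p ^ 2])) : ℝ)
        ≤ (((b - a) / p ^ 2 + 1 : ℕ) : ℝ) := by exact_mod_cast h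
      _ = (((b - a) / p ^ 2 : ℕ) : ℝ) + 1 := by push_cast; ring
      _ ≤ ((b - a : ℕ) : ℝ) / (p : ℝ) ^ 2 + 1 := by
          have := Nat.cast_div_le (m := b - a) (n := p ^ 2) (α := ℝ)
          push_cast at this
          linarith
      _ ≤ (η * X + 1) / (p : ℝ) ^ 2 + 1 := by
          gcongr
  calc (#S : ℝ) ≤ #T := by exact_mod_cast card_le_card hcover
    _ ≤ ∑ ry ∈ Rt ×ˢ Y, (#((Y.filter (fun x => x ≡ ry.1 * ry.2 [MOD p ^ 2])).map
          ⟨fun x => (x, ry.2), fun x₁ x₂ h => (Prod.ext_iff.mp h).1⟩) : ℝ) := by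
        rw [hT]; exact_mod_cast card_biUnion_le
    _ ≤ ∑ ry ∈ Rt ×ˢ Y, ((η * X + 1) / (p : ℝ) ^ 2 + 1) := sum_le_sum hfib
    _ = #Rt * #Y * ((η * X + 1) / (p : ℝ) ^ 2 + 1) := by
        rw [sum_const, card_product, nsmul_eq_mul]; push_cast; ring
    _ ≤ 3 * (η * X + 1) * ((η * X + 1) / (p : ℝ) ^ 2 + 1) := by
        have h3 : (#Rt : ℝ) ≤ 3 := by exact_mod_cast hRt3
        have h0 : (0 : ℝ) ≤ (η * X + 1) / (p : ℝ) ^ 2 + 1 := by positivity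
        have hY0 : (0 : ℝ) ≤ #Y := Nat.cast_nonneg _
        exact mul_le_mul_of_nonneg_right (mul_le_mul h3 hYcard hY0 (by norm_num)) h0


/-- **Summed over the primes `X^τ ≤ p ≤ P`** (`X^τ ≥ 5`): with `∑_{p ≥ X^τ} p^{-2} ≤ 2X^{-τ}`,
`∑_p #{(x, y) : p² ∣ x³ + 2y³} ≤ 3(ηX + 1)((ηX + 1)·2X^{-τ} + P + 1)`. [folklore] -/
theorem sum_card_boxPairs_sq_dvd_le {X η τ : ℝ} (hX : 0 < X) (hη : 0 < η) (hXτ : 5 ≤ X ^ τ)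
    {P : ℝ} (hP : 0 ≤ P) :
    ∑ p ∈ (range (⌊P⌋₊ + 1)).filter (fun p : ℕ => p.Prime ∧ X ^ τ ≤ (p : ℝ)),
        (#{xy ∈ boxPairs X η | p ^ 2 ∣ xy.1 ^ 3 + 2 * xy.2 ^ 3} : ℝ) ≤
      3 * (η * X + 1) * ((η * X + 1) * (2 / X ^ τ) + (P + 1)) := by
  classical
  set PP := (range (⌊P⌋₊ + 1)).filter (fun p : ℕ => p.Prime ∧ X ^ τ ≤ (p : ℝ)) with hPP
  have hmem : ∀ p ∈ PP, p.Prime ∧ X ^ τ ≤ (p : ℝ) ∧ p < ⌊P⌋₊ + 1 := fun p hp => by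
    rw [hPP, mem_filter, mem_range] at hp; exact ⟨hp.2.1, hp.2.2, hp.1⟩
  have hXτ0 : 0 < X ^ τ := by linarith
  have hterm : ∀ p ∈ PP, (#{xy ∈ boxPairs X η | p ^ 2 ∣ xy.1 ^ 3 + 2 * xy.2 ^ 3} : ℝ) ≤
      3 * (η * X + 1) * ((η * X + 1) * ((p : ℝ) ^ 2)⁻¹ + 1) := by
    intro p hp
    obtain ⟨hpr, hpX, -⟩ := hmem p hp
    have hp5 : 5 ≤ p := by
      have : (5 : ℝ) ≤ p := hXτ.trans hpX
      exact_mod_cast this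
    have h := card_boxPairs_sq_dvd_le hX hη hpr hp5
    rwa [div_eq_mul_inv] at h
  -- `∑_{p ∈ PP} p^{-2} ≤ 2/X^τ`
  set k : ℕ := ⌈X ^ τ⌉₊ - 1 with hk
  have hk1 : 1 ≤ ⌈X ^ τ⌉₊ := Nat.one_le_iff_ne_zero.mpr (Nat.ceil_pos.mpr hXτ0).ne'
  have hsub : PP ⊆ Ioo k (⌊P⌋₊ + 1) := by
    intro p hp
    obtain ⟨-, hpX, hplt⟩ := hmem p hp
    rw [mem_Ioo]
    refine ⟨?_, hplt⟩
    have : ⌈X ^ τ⌉₊ ≤ p := Nat.ceil_le.mpr hpX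
    omega
  have hinv : ∑ p ∈ PP, ((p : ℝ) ^ 2)⁻¹ ≤ 2 / X ^ τ := by
    calc ∑ p ∈ PP, ((p : ℝ) ^ 2)⁻¹ ≤ ∑ i ∈ Ioo k (⌊P⌋₊ + 1), ((i : ℝ) ^ 2)⁻¹ :=
          sum_le_sum_of_subset_of_nonneg hsub fun i _ _ => by positivity
      _ ≤ 2 / ((k : ℝ) + 1) := sum_Ioo_inv_sq_le k _
      _ ≤ 2 / X ^ τ := by
          refine div_le_div_of_nonneg_left (by norm_num) hXτ0 ?_
          have : ((k : ℝ) + 1) = (⌈X ^ τ⌉₊ : ℝ) := by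
            rw [hk, Nat.cast_sub hk1]; push_cast; ring
          rw [this]; exact Nat.le_ceil _
  have hcard : (#PP : ℝ) ≤ P + 1 := by
    calc (#PP : ℝ) ≤ #(range (⌊P⌋₊ + 1)) := by exact_mod_cast card_le_card (filter_subset _ _)
      _ = (⌊P⌋₊ : ℝ) + 1 := by rw [card_range]; push_cast; ring
      _ ≤ P + 1 := by linarith [Nat.floor_le hP]
  have hηX : 0 ≤ η * X + 1 := by positivity
  calc ∑ p ∈ PP, (#{xy ∈ boxPairs X η | p ^ 2 ∣ xy.1 ^ 3 + 2 * xy.2 ^ 3} : ℝ)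
      ≤ ∑ p ∈ PP, 3 * (η * X + 1) * ((η * X + 1) * ((p : ℝ) ^ 2)⁻¹ + 1) := sum_le_sum hterm
    _ = 3 * (η * X + 1) * ((η * X + 1) * ∑ p ∈ PP, ((p : ℝ) ^ 2)⁻¹ + #PP) := by
        rw [← mul_sum, sum_add_distrib, ← mul_sum, sum_const, nsmul_eq_mul, mul_one]
    _ ≤ 3 * (η * X + 1) * ((η * X + 1) * (2 / X ^ τ) + (P + 1)) := by
        gcongr

/-- **Eventually (in `X`)**: `B ≤ τ^k log X` and `τ ≤ c`, for `τ = (log log X)^{−ϖ}`, `0 < ϖ ≤ 1`,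
any `k`, `B` and `c > 0` (`τ^k log X ≥ log X/(log log X)^k → ∞`). [folklore] -/
theorem eventually_hbTau_pow_mul_log {ϖ : ℝ} (hϖ0 : 0 < ϖ) (hϖ1 : ϖ ≤ 1) (k : ℕ) (B : ℝ) {c : ℝ}
    (hc : 0 < c) :
    ∀ᶠ X : ℝ in atTop, B ≤ hbTau ϖ X ^ k * Real.log X ∧ hbTau ϖ X ≤ c := by
  have hτ0 : Tendsto (fun X : ℝ => hbTau ϖ X) atTop (𝓝 0) := by
    have : (fun X : ℝ => hbTau ϖ X) = fun X => (Real.log (Real.log X)) ^ (-ϖ) := rfl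
    rw [this]
    exact (tendsto_rpow_neg_atTop hϖ0).comp (Real.tendsto_log_atTop.comp Real.tendsto_log_atTop)
  have hc' : ∀ᶠ X : ℝ in atTop, hbTau ϖ X ≤ c := hτ0.eventually (ge_mem_nhds hc)
  have hlog : ∀ᶠ L : ℝ in atTop, ‖Real.log L ^ k‖ ≤ (1 / (|B| + 1)) * ‖id L‖ :=
    (Real.isLittleO_pow_log_id_atTop (n := k)).def (by positivity)
  filter_upwards [hc', Real.tendsto_log_atTop.eventually hlog,
    (Real.tendsto_log_atTop.comp Real.tendsto_log_atTop).eventually (eventually_ge_atTop (1 : ℝ)),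
    Real.tendsto_log_atTop.eventually (eventually_gt_atTop (0 : ℝ))] with X hcX hlogX hM1 hL0
  set L := Real.log X with hL
  set M := Real.log L with hM
  have hM1' : 1 ≤ M := hM1
  have hM0 : 0 < M := by linarith
  have hτ : hbTau ϖ X = M ^ (-ϖ) := rfl
  have hτlow : M⁻¹ ≤ hbTau ϖ X := by
    rw [hτ, Real.rpow_neg hM0.le]
    refine inv_anti₀ (Real.rpow_pos_of_pos hM0 _) ?_
    calc M ^ ϖ ≤ M ^ (1 : ℝ) := Real.rpow_le_rpow_of_exponent_le hM1' hϖ1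
      _ = M := Real.rpow_one M
  have hMk : 0 < M ^ k := pow_pos hM0 k
  have hk : (M ^ k)⁻¹ ≤ hbTau ϖ X ^ k := by
    rw [← inv_pow]; exact pow_le_pow_left₀ (by positivity) hτlow k
  have hlog' : M ^ k ≤ 1 / (|B| + 1) * L := by
    have h := hlogX
    simp only [Real.norm_eq_abs, id] at h
    rwa [abs_of_nonneg (pow_nonneg hM0.le k), abs_of_pos hL0] at h
  have h1 : |B| + 1 ≤ L * (M ^ k)⁻¹ := by
    rw [← div_eq_mul_inv, le_div_iff₀ hMk]
    calc (|B| + 1) * M ^ k ≤ (|B| + 1) * (1 / (|B| + 1) * L) := by gcongr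
      _ = L := by field_simp
  refine ⟨?_, hcX⟩
  calc B ≤ |B| + 1 := by linarith [le_abs_self B]
    _ ≤ L * (M ^ k)⁻¹ := h1
    _ ≤ L * hbTau ϖ X ^ k := mul_le_mul_of_nonneg_left hk hL0.le
    _ = hbTau ϖ X ^ k * L := mul_comm _ _


section FamilyA

variable {X η τ : ℝ} {n : ℕ}

open scoped Classical in
/-- **(E1) vanishes for `𝒜^(K)`**: a non-good chain index (a prime of degree `≥ 2`, or two primes
of equal norm) divides no member of `𝒜^(K)` (Lemma 3.1). [cite: HeathBrownActa2001, Lemma 3.1] -/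
theorem E1_A_eq_zero (X η τ : ℝ) (n : ℕ) :
    ∑ t ∈ (Upairs X τ n).filter (fun t => ¬ UGood t),
      (famCount (boxPairs X η) pairIdeal (uIdeal t) : ℝ) = 0 := by
  refine sum_eq_zero fun t ht => ?_
  obtain ⟨ht1, ht2⟩ := mem_filter.mp ht
  rw [famCount_boxPairs, countA_uIdeal_eq_zero_of_not_good ht1 ht2, Nat.cast_zero]

open scoped Classical in
/-- **(E3ii) vanishes for `𝒜^(K)`**: a Buchstab prime `Q ≺ P_{n+1}` of degree `≥ 2`, or with
`N(Q) = N(P_j)` for some `j` (then `Q ≠ P_j`), divides no member of `𝒜^(K)` together with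
`P_1⋯P_{n+1}` (Lemma 3.1). [cite: HeathBrownActa2001, Lemma 3.1] -/
theorem E3ii_A_eq_zero (hX : 1 < X) (hτ : 0 < τ) (hτ1 : τ ≤ 1) (η : ℝ) (n : ℕ) :
    ∑ b ∈ (mIndexU τ n).sigma (fun m => Fintype.piFinset fun i => Jprimes X τ (m i)),
      ∑ Q ∈ ((idealsLE (Ideal.absNorm (b.2 (Fin.last n)))).filter
          (fun Q => Q.IsPrime ∧ Q ≠ ⊥ ∧ X ^ ((b.1 (Fin.last n) : ℝ) * hbXi τ) ≤ (Ideal.absNorm Q : ℝ) ∧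
            PrimeLT Q (b.2 (Fin.last n)))).filter
          (fun Q => ¬ ((Ideal.absNorm Q).Prime ∧ ∀ j, Ideal.absNorm Q ≠ Ideal.absNorm (b.2 j))),
        (famCount (boxPairs X η) pairIdeal (Q * ∏ j, b.2 j) : ℝ) = 0 := by
  refine sum_eq_zero fun b hb => sum_eq_zero fun Q hQ => ?_
  obtain ⟨hm, hP⟩ := mem_sigma.mp hb
  obtain ⟨-, hPj, -, hSA, -⟩ := U_index_props hX hτ hτ1 hm hP
  rw [mem_filter, mem_filter] at hQ
  obtain ⟨⟨-, hQp, hQ0, -, hQlt⟩, hnot⟩ := hQ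
  rw [famCount_boxPairs]
  by_cases hprime : (Ideal.absNorm Q).Prime
  · have hex : ∃ j, Ideal.absNorm Q = Ideal.absNorm (b.2 j) := by
      by_contra h
      push Not at h
      exact hnot ⟨hprime, h⟩
    obtain ⟨j, hj⟩ := hex
    have hne : Q ≠ b.2 j := by
      rintro rfl
      by_cases hjl : j = Fin.last n
      · rw [hjl] at hQlt; exact primeLT_irrefl _ hQlt
      · have hlt : j < Fin.last n := lt_of_le_of_ne (Fin.le_last j) hjl
        have h1 : Ideal.absNorm (b.2 (Fin.last n)) < Ideal.absNorm (b.2 j) := hSA hlt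
        have h2 : Ideal.absNorm (b.2 j) ≤ Ideal.absNorm (b.2 (Fin.last n)) := hQlt.absNorm_le
        omega
    rw [countA_eq_zero_of_absNorm_eq hQp hQ0 (hPj j).1 hne hj (dvd_mul_right Q _)
      ((Finset.dvd_prod_of_mem _ (mem_univ j)).trans (dvd_mul_left _ Q)), Nat.cast_zero]
  · rw [countA_eq_zero_of_not_prime hQp hQ0 (dvd_mul_right Q _) hprime, Nat.cast_zero]

/-- **A square-free defect in `𝒜^(K)` forces `p² ∣ x³ + 2y³` for a prime `X^τ ≤ p ≤ 5X^{1−τ/2}`.**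
If `P_1⋯P_{n+1} ∣ (x + yθ)`, the member is `X^{m_{n+1}ξ}`-rough and the cofactor `R` has `N(R)` not
square-free, then (Lemma 3.1) `R` is not square-free, so `P² ∣ R` for a prime ideal `P`, of prime
norm `p ≥ X^τ` with `p² ≤ N(R) ≤ 24X³/X^{1+τ}`. [cite: HeathBrownActa2001, Lemma 3.1] -/
theorem exists_prime_sq_dvd_of_defect (hX : (24 : ℝ) ≤ X) (hτ : 0 < τ) (hτ1 : τ ≤ 1) (hη1 : η ≤ 1)
    {xy : ℕ × ℕ} (hxy : xy ∈ boxPairs X η) {m : Fin (n + 1) → ℕ} (hm : m ∈ mIndexU τ n)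
    {P : Fin (n + 1) → Ideal (𝓞 K)} (hP : P ∈ Fintype.piFinset fun i => Jprimes X τ (m i))
    (hdvd : (∏ j, P j) ∣ pairIdeal xy)
    (hrough : IsRough (X ^ ((m (Fin.last n) : ℝ) * hbXi τ)) (pairIdeal xy))
    (hsq : ¬ Squarefree (Ideal.absNorm (pairIdeal xy) / Ideal.absNorm (∏ j, P j))) :
    ∃ p : ℕ, p.Prime ∧ X ^ τ ≤ (p : ℝ) ∧ (p : ℝ) ≤ 5 * X ^ (1 - τ / 2) ∧
      p ^ 2 ∣ xy.1 ^ 3 + 2 * xy.2 ^ 3 := by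
  classical
  have hX1 : 1 < X := by linarith
  have hX0 : 0 < X := by linarith
  obtain ⟨-, hPj, -, -, -, hprodge, -, -, -, hzτ⟩ := U_index_props hX1 hτ hτ1 hm hP
  set I := pairIdeal xy with hI
  set S := ∏ j, P j with hS
  have hI0 : I ≠ ⊥ := pairIdeal_ne_bot_of_mem_boxPairs hX0.le xy hxy
  have hcop : IsCoprime (xy.1 : ℤ) (xy.2 : ℤ) :=
    Nat.isCoprime_iff_coprime.mpr (mem_boxPairs_iff.mp hxy).2.2.2.2
  obtain ⟨R, hR⟩ := hdvd
  have hS0 : S ≠ ⊥ := by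
    rw [hS]; exact Finset.prod_ne_zero_iff.mpr fun j _ => (hPj j).2.1
  have hNS : 0 < Ideal.absNorm S := Nat.pos_of_ne_zero fun h => hS0 (Ideal.absNorm_eq_zero_iff.mp h)
  have hquot : Ideal.absNorm I / Ideal.absNorm S = Ideal.absNorm R := by
    rw [hR, map_mul, Nat.mul_div_cancel_left _ hNS]
  rw [hquot] at hsq
  have hR0 : R ≠ ⊥ := by rintro rfl; exact hI0 (by rw [hR, Ideal.mul_bot])
  have hRI : R ∣ I := ⟨S, by rw [hR, mul_comm]⟩
  have hmemR := intCast_mem_of_dvd_pairIdeal hRI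
  have hRnsf : ¬ Squarefree R := fun h => hsq (squarefree_absNorm_of_mem hcop h hmemR)
  obtain ⟨Q, hQQ, hQu⟩ : ∃ Q : Ideal (𝓞 K), Q * Q ∣ R ∧ ¬ IsUnit Q := by
    by_contra h
    push Not at h
    exact hRnsf h
  have hQtop : Q ≠ ⊤ := fun h => hQu (Ideal.isUnit_iff.mpr h)
  obtain ⟨P₀, hP₀max, hQP₀⟩ := Ideal.exists_le_maximal Q hQtop
  have hP₀ : P₀.IsPrime := hP₀max.isPrime
  have hP₀Q : P₀ ∣ Q := Ideal.dvd_iff_le.mpr hQP₀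
  have hP₀R : P₀ * P₀ ∣ R := (mul_dvd_mul hP₀Q hP₀Q).trans hQQ
  have hP₀I : P₀ ∣ I := ((dvd_mul_right P₀ P₀).trans hP₀R).trans hRI
  have hP₀0 : P₀ ≠ ⊥ := by
    rintro rfl
    exact hR0 (Ideal.dvd_iff_le.mp ((dvd_mul_right ⊥ ⊥).trans hP₀R) |>.antisymm bot_le ▸ rfl)
  have hmemP₀ := intCast_mem_of_dvd_pairIdeal hP₀I
  have hp : (Ideal.absNorm P₀).Prime := prime_absNorm_of_mem hcop hP₀ hP₀0 hmemP₀
  set p := Ideal.absNorm P₀ with hp_def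
  refine ⟨p, hp, ?_, ?_, ?_⟩
  · exact hzτ.trans (hrough hP₀ hP₀I)
  · -- `p² ≤ N(R)`, `N(R) X^{1+τ} ≤ N(R) N(S) = N(I) ≤ 24 X³`
    have hNR0 : 0 < Ideal.absNorm R := Nat.pos_of_ne_zero fun h => hR0 (Ideal.absNorm_eq_zero_iff.mp h)
    have h1 : p ^ 2 ≤ Ideal.absNorm R := by
      have := Nat.le_of_dvd hNR0 (map_dvd Ideal.absNorm hP₀R)
      rwa [map_mul, ← sq] at this
    have h1' : (p : ℝ) ^ 2 ≤ Ideal.absNorm R := by exact_mod_cast h1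
    have hNS' : X ^ (1 + τ) ≤ (Ideal.absNorm S : ℝ) := by
      rw [hS, map_prod, Nat.cast_prod]; exact hprodge
    have hNI : (Ideal.absNorm I : ℝ) ≤ 24 * X ^ 3 := (absNorm_pairIdeal_bounds hX0 hη1 hxy).2
    have hNI' : (Ideal.absNorm I : ℝ) = Ideal.absNorm S * Ideal.absNorm R := by
      rw [hR, map_mul]; push_cast; ring
    have h2 : (p : ℝ) ^ 2 * X ^ (1 + τ) ≤ 24 * X ^ 3 := by
      calc (p : ℝ) ^ 2 * X ^ (1 + τ) ≤ Ideal.absNorm R * Ideal.absNorm S :=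
            mul_le_mul h1' hNS' (by positivity) (Nat.cast_nonneg _)
        _ = Ideal.absNorm I := by rw [hNI']; ring
        _ ≤ 24 * X ^ 3 := hNI
    have h3 : (24 : ℝ) * X ^ 3 = 24 * (X ^ (1 - τ / 2)) ^ 2 * X ^ (1 + τ) := by
      rw [← Real.rpow_natCast (X ^ (1 - τ / 2)) 2, ← Real.rpow_mul hX0.le]
      rw [show ((24 : ℝ) * X ^ 3) = 24 * X ^ ((1 - τ / 2) * (2 : ℕ) + (1 + τ)) by
        rw [show ((1 - τ / 2) * (2 : ℕ) + (1 + τ) : ℝ) = (3 : ℕ) by push_cast; ring, Real.rpow_natCast]]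
      rw [Real.rpow_add hX0]; ring
    rw [h3] at h2
    have hX1τ : 0 < X ^ (1 + τ) := Real.rpow_pos_of_pos hX0 _
    have h4 : (p : ℝ) ^ 2 ≤ 24 * (X ^ (1 - τ / 2)) ^ 2 := le_of_mul_le_mul_right h2 hX1τ
    have h5 : (p : ℝ) ^ 2 ≤ (5 * X ^ (1 - τ / 2)) ^ 2 := by
      have : 0 ≤ (X ^ (1 - τ / 2)) ^ 2 := by positivity
      nlinarith
    exact le_of_pow_le_pow_left₀ two_ne_zero (by positivity) h5
  · have h1 : p ^ 2 ∣ Ideal.absNorm R := by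
      have := map_dvd Ideal.absNorm hP₀R
      rwa [map_mul, ← sq] at this
    have h2 : Ideal.absNorm R ∣ Ideal.absNorm I := map_dvd Ideal.absNorm hRI
    rw [← absNorm_pairIdeal]
    exact h1.trans h2

open scoped Classical in
/-- **At most `2^{4/τ}` chain tuples divide a given member of `𝒜^(K)`**: `b ↦ {P_1, …, P_{n+1}}`
injects the tuples with `P_1⋯P_{n+1} ∣ I` into the subsets of the `≤ 4/τ` prime ideals of norm
`≥ X^τ` dividing `I` (`N(I) ≤ 24X³ ≤ X⁴`). [folklore] -/
theorem card_chainTuples_dvd_le (hX : (24 : ℝ) ≤ X) (hτ : 0 < τ) (hτ1 : τ ≤ 1) (hη1 : η ≤ 1)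
    {xy : ℕ × ℕ} (hxy : xy ∈ boxPairs X η) (n : ℕ) :
    (#{b ∈ (mIndexU τ n).sigma (fun m => Fintype.piFinset fun i => Jprimes X τ (m i)) |
        (∏ j, b.2 j) ∣ pairIdeal xy} : ℝ) ≤ (2 : ℝ) ^ (4 / τ) := by
  classical
  have hX1 : 1 < X := by linarith
  have hX0 : 0 < X := by linarith
  set I := pairIdeal xy with hI
  have hI0 : I ≠ ⊥ := pairIdeal_ne_bot_of_mem_boxPairs hX0.le xy hxy
  set A := (mIndexU τ n).sigma (fun m => Fintype.piFinset fun i => Jprimes X τ (m i)) with hA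
  set PF := (UniqueFactorizationMonoid.normalizedFactors I).toFinset.filter
    (fun P => X ^ τ ≤ (Ideal.absNorm P : ℝ)) with hPF
  -- the injection
  have hmaps : ∀ b ∈ A.filter (fun b => (∏ j, b.2 j) ∣ I), (univ.image b.2) ∈ PF.powerset := by
    intro b hb
    obtain ⟨hbA, hbd⟩ := mem_filter.mp hb
    obtain ⟨hm, hP⟩ := mem_sigma.mp hbA
    obtain ⟨-, hPj, hsmall, -⟩ := U_index_props hX1 hτ hτ1 hm hP
    rw [mem_powerset]
    intro P hPm
    obtain ⟨j, -, rfl⟩ := mem_image.mp hPm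
    rw [hPF, mem_filter, Multiset.mem_toFinset, Ideal.mem_normalizedFactors_iff hI0]
    refine ⟨⟨(hPj j).1, Ideal.le_of_dvd ((Finset.dvd_prod_of_mem _ (mem_univ j)).trans hbd)⟩, ?_⟩
    exact (mem_smallPrimes_iff.mp (hsmall j)).2.2.1
  have hinj : Set.InjOn (fun b : (Σ _ : Fin (n + 1) → ℕ, Fin (n + 1) → Ideal (𝓞 K)) => univ.image b.2)
      (A.filter (fun b => (∏ j, b.2 j) ∣ I)) := by
    intro b hb b' hb' heq
    simp only at heq
    obtain ⟨hbA, -⟩ := mem_filter.mp hb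
    obtain ⟨hbA', -⟩ := mem_filter.mp hb'
    obtain ⟨hm, hP⟩ := mem_sigma.mp hbA
    obtain ⟨hm', hP'⟩ := mem_sigma.mp hbA'
    obtain ⟨-, -, -, hSA, -⟩ := U_index_props hX1 hτ hτ1 hm hP
    obtain ⟨-, -, -, hSA', -⟩ := U_index_props hX1 hτ hτ1 hm' hP'
    have hinjb : Set.InjOn b.2 (univ : Finset (Fin (n + 1))) :=
      fun i _ j _ h => hSA.injective (congrArg Ideal.absNorm h)
    have hinjb' : Set.InjOn b'.2 (univ : Finset (Fin (n + 1))) :=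
      fun i _ j _ h => hSA'.injective (congrArg Ideal.absNorm h)
    have hprod : ∏ j, b.2 j = ∏ j, b'.2 j := by
      rw [← prod_image (f := fun P => P) hinjb, ← prod_image (f := fun P => P) hinjb', heq]
    have hanti : StrictAnti b.1 := ((mem_mIndexU_iff hτ).mp hm).1.1
    have hanti' : StrictAnti b'.1 := ((mem_mIndexU_iff hτ).mp hm').1.1
    obtain ⟨h2, h1⟩ := tuple_eq_of_prod_eq hX1 hτ hanti hanti' hP hP' hprod
    exact Sigma.ext h1 (heq_of_eq h2)
  have hcard : #(A.filter (fun b => (∏ j, b.2 j) ∣ I)) ≤ 2 ^ #PF := by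
    rw [← card_powerset]
    exact card_le_card_of_injOn _ hmaps hinj
  -- `#PF ≤ 4/τ`
  have hprime : ∀ P ∈ PF, Prime P := fun P hP =>
    UniqueFactorizationMonoid.prime_of_normalized_factor P (Multiset.mem_toFinset.mp (mem_filter.mp hP).1)
  have hdiv : ∀ P ∈ PF, P ∣ I := fun P hP =>
    UniqueFactorizationMonoid.dvd_of_mem_normalizedFactors (Multiset.mem_toFinset.mp (mem_filter.mp hP).1)
  have hprodI : ∏ P ∈ PF, P ∣ I := Finset.prod_primes_dvd I hprime hdiv
  have hNI0 : 0 < Ideal.absNorm I := Nat.pos_of_ne_zero fun h => hI0 (Ideal.absNorm_eq_zero_iff.mp h)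
  have hNle : (Ideal.absNorm (∏ P ∈ PF, P) : ℝ) ≤ 24 * X ^ 3 :=
    le_trans (by exact_mod_cast Nat.le_of_dvd hNI0 (map_dvd Ideal.absNorm hprodI))
      (absNorm_pairIdeal_bounds hX0 hη1 hxy).2
  have hXτ0 : 0 < X ^ τ := Real.rpow_pos_of_pos hX0 _
  have hpow : (X ^ τ) ^ #PF ≤ (Ideal.absNorm (∏ P ∈ PF, P) : ℝ) := by
    rw [map_prod, Nat.cast_prod, ← prod_const]
    exact prod_le_prod (fun _ _ => hXτ0.le) fun P hP => (mem_filter.mp hP).2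
  have h4 : (X ^ τ) ^ #PF ≤ X ^ (4 : ℝ) := by
    refine hpow.trans (hNle.trans ?_)
    have : X ^ (4 : ℝ) = X * X ^ 3 := by
      rw [show (4 : ℝ) = ((4 : ℕ) : ℝ) by norm_num, Real.rpow_natCast]; ring
    rw [this]
    exact mul_le_mul_of_nonneg_right hX (by positivity)
  rw [← Real.rpow_natCast, ← Real.rpow_mul hX0.le] at h4
  have h5 : τ * (#PF : ℝ) ≤ 4 := (Real.rpow_le_rpow_left_iff hX1).mp h4
  have h6 : (#PF : ℝ) ≤ 4 / τ := by rw [le_div_iff₀ hτ]; linarith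
  calc (#(A.filter (fun b => (∏ j, b.2 j) ∣ I)) : ℝ) ≤ ((2 ^ #PF : ℕ) : ℝ) := by exact_mod_cast hcard
    _ = (2 : ℝ) ^ (#PF : ℝ) := by push_cast; rw [Real.rpow_natCast]
    _ ≤ (2 : ℝ) ^ (4 / τ) := Real.rpow_le_rpow_of_exponent_le (by norm_num) h6


open scoped Classical in
/-- **(E4) for `𝒜^(K)`**: the square-free defect of `Û^{(𝐦,n)}(𝒜)` is at most
`2^{4/τ} · ∑_{X^τ ≤ p ≤ 5X^{1−τ/2}} #{(x, y) : p² ∣ x³ + 2y³} ≤ 2^{4/τ}·3(ηX+1)((ηX+1)·2X^{−τ} + 5X^{1−τ/2} + 1)`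
(swap the sums; `exists_prime_sq_dvd_of_defect`, `card_chainTuples_dvd_le`, `sum_card_boxPairs_sq_dvd_le`).
[cite: HeathBrownActa2001, §7 p. 45] -/
theorem E4_A_le (hX : (24 : ℝ) ≤ X) (hτ : 0 < τ) (hτ1 : τ ≤ 1) (hη : 0 < η) (hη1 : η ≤ 1)
    (hXτ : 5 ≤ X ^ τ) (n : ℕ) :
    ∑ b ∈ (mIndexU τ n).sigma (fun m => Fintype.piFinset fun i => Jprimes X τ (m i)),
        (#{xy ∈ boxPairs X η | (∏ j, b.2 j) ∣ pairIdeal xy ∧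
            IsRough (X ^ ((b.1 (Fin.last n) : ℝ) * hbXi τ)) (pairIdeal xy) ∧
            ¬ Squarefree (Ideal.absNorm (pairIdeal xy) / Ideal.absNorm (∏ j, b.2 j))} : ℝ) ≤
      (2 : ℝ) ^ (4 / τ) *
        (3 * (η * X + 1) * ((η * X + 1) * (2 / X ^ τ) + (5 * X ^ (1 - τ / 2) + 1))) := by
  classical
  have hX0 : 0 < X := by linarith
  set A := (mIndexU τ n).sigma (fun m => Fintype.piFinset fun i => Jprimes X τ (m i)) with hA
  set PP := (range (⌊5 * X ^ (1 - τ / 2)⌋₊ + 1)).filter (fun p : ℕ => p.Prime ∧ X ^ τ ≤ (p : ℝ))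
    with hPP
  set cond : (Σ _ : Fin (n + 1) → ℕ, Fin (n + 1) → Ideal (𝓞 K)) → ℕ × ℕ → Prop := fun b xy =>
    (∏ j, b.2 j) ∣ pairIdeal xy ∧ IsRough (X ^ ((b.1 (Fin.last n) : ℝ) * hbXi τ)) (pairIdeal xy) ∧
      ¬ Squarefree (Ideal.absNorm (pairIdeal xy) / Ideal.absNorm (∏ j, b.2 j)) with hcond
  change ∑ b ∈ A, (#{xy ∈ boxPairs X η | cond b xy} : ℝ) ≤ _
  -- swap the two sums
  have hswap : ∑ b ∈ A, (#{xy ∈ boxPairs X η | cond b xy} : ℝ) =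
      ∑ xy ∈ boxPairs X η, (#{b ∈ A | cond b xy} : ℝ) := by
    simp only [card_filter, Nat.cast_sum]
    exact sum_comm
  rw [hswap]
  -- pointwise: at most `2^{4/τ}`, and zero unless `p² ∣ x³ + 2y³` for some `p ∈ PP`
  have hpt : ∀ xy ∈ boxPairs X η, (#{b ∈ A | cond b xy} : ℝ) ≤
      if ∃ p ∈ PP, p ^ 2 ∣ xy.1 ^ 3 + 2 * xy.2 ^ 3 then (2 : ℝ) ^ (4 / τ) else 0 := by
    intro xy hxy
    rcases (A.filter (fun b => cond b xy)).eq_empty_or_nonempty with h0 | ⟨b, hb⟩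
    · rw [h0, card_empty, Nat.cast_zero]
      split_ifs <;> positivity
    · obtain ⟨hbA, hbc⟩ := mem_filter.mp hb
      obtain ⟨hm, hP⟩ := mem_sigma.mp hbA
      obtain ⟨p, hp, hpX, hp5, hpd⟩ :=
        exists_prime_sq_dvd_of_defect hX hτ hτ1 hη1 hxy hm hP hbc.1 hbc.2.1 hbc.2.2
      have hpPP : p ∈ PP := by
        rw [hPP, mem_filter, mem_range, Nat.lt_add_one_iff]
        exact ⟨Nat.le_floor hp5, hp, hpX⟩
      rw [if_pos ⟨p, hpPP, hpd⟩]
      calc (#{b ∈ A | cond b xy} : ℝ) ≤ #{b ∈ A | (∏ j, b.2 j) ∣ pairIdeal xy} := by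
            exact_mod_cast card_le_card (fun b hb => by
              obtain ⟨h1, h2⟩ := mem_filter.mp hb
              exact mem_filter.mpr ⟨h1, h2.1⟩)
        _ ≤ (2 : ℝ) ^ (4 / τ) := card_chainTuples_dvd_le hX hτ hτ1 hη1 hxy n
  refine (sum_le_sum hpt).trans ?_
  rw [← sum_filter, sum_const, nsmul_eq_mul, mul_comm]
  refine mul_le_mul_of_nonneg_left ?_ (by positivity)
  -- the union bound over `p ∈ PP`
  have hsub : (boxPairs X η).filter (fun xy => ∃ p ∈ PP, p ^ 2 ∣ xy.1 ^ 3 + 2 * xy.2 ^ 3) ⊆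
      PP.biUnion (fun p => (boxPairs X η).filter (fun xy => p ^ 2 ∣ xy.1 ^ 3 + 2 * xy.2 ^ 3)) := by
    intro xy hxy
    obtain ⟨hxyb, p, hp, hpd⟩ := mem_filter.mp hxy
    exact mem_biUnion.mpr ⟨p, hp, mem_filter.mpr ⟨hxyb, hpd⟩⟩
  calc (#((boxPairs X η).filter (fun xy => ∃ p ∈ PP, p ^ 2 ∣ xy.1 ^ 3 + 2 * xy.2 ^ 3)) : ℝ)
      ≤ #(PP.biUnion (fun p => (boxPairs X η).filter (fun xy => p ^ 2 ∣ xy.1 ^ 3 + 2 * xy.2 ^ 3))) := by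
        exact_mod_cast card_le_card hsub
    _ ≤ ∑ p ∈ PP, (#((boxPairs X η).filter (fun xy => p ^ 2 ∣ xy.1 ^ 3 + 2 * xy.2 ^ 3)) : ℝ) := by
        exact_mod_cast card_biUnion_le
    _ ≤ 3 * (η * X + 1) * ((η * X + 1) * (2 / X ^ τ) + (5 * X ^ (1 - τ / 2) + 1)) :=
        sum_card_boxPairs_sq_dvd_le hX0 hη hXτ (by positivity)


/-- Scalar absorption for the `𝒜`-bounds: with `ηX ≥ 1`, `2^{4/τ} ≤ X^{τ/4}`, `τ^{-1} ≤ L`,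
`X^{-τ/5}L³ ≤ τη²/L` (from (2.1), (2.5)), the three terms `n₀·E4`, the main weight term and the
Lemma 7.1 error are together `≤ (C₇'(1600 + 700C₁) + 140C₇' + 120)·τ·η²X²/L`. [folklore] -/
theorem A_final_absorb {X L τ η C₁ C₇' NB : ℝ} (hX1 : 1 < X) (hL1 : 1 ≤ L) (hτ0 : 0 < τ)
    (hτ1 : τ ≤ 1) (hη0 : 0 < η) (hη1 : η ≤ 1) (hC₇' : 0 ≤ C₇') (hC₁ : 0 ≤ C₁) (hηX1 : 1 ≤ η * X)
    (hXτ5 : 5 ≤ X ^ τ) (h2pow : (2 : ℝ) ^ (4 / τ) ≤ X ^ (τ / 4)) (hτinvL : 1 / τ ≤ L)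
    (hNB : NB ≤ 1 / τ + 1) (habs' : X ^ (-τ / 5) * L ^ 3 ≤ τ * η ^ 2 / L) :
    NB * ((2 : ℝ) ^ (4 / τ) *
        (3 * (η * X + 1) * ((η * X + 1) * (2 / X ^ τ) + (5 * X ^ (1 - τ / 2) + 1)))) +
      C₇' * (η ^ 2 * X ^ 2 / (τ * L)) * ((1600 + 700 * C₁) * τ ^ 2) +
      70 * (1 / τ + 1) * L * (C₇' * X ^ (2 - τ / 5)) ≤
    (C₇' * (1600 + 700 * C₁) + 140 * C₇' + 120) * τ * (η ^ 2 * X ^ 2 / L) := by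
  have hX0 : 0 < X := by linarith
  have hL0 : 0 < L := by linarith
  set E4A : ℝ := (2 : ℝ) ^ (4 / τ) *
    (3 * (η * X + 1) * ((η * X + 1) * (2 / X ^ τ) + (5 * X ^ (1 - τ / 2) + 1))) with hE4A
  have hE4A0 : 0 ≤ E4A := by rw [hE4A]; positivity
  have hX1τ2 : 1 ≤ X ^ (1 - τ / 2) := Real.one_le_rpow hX1.le (by linarith)
  have hXτmono : X ^ (1 - τ) ≤ X ^ (1 - τ / 2) :=
    Real.rpow_le_rpow_of_exponent_le hX1.le (by linarith)
  have hXτ0 : 0 < X ^ τ := by linarith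
  have hb1 : (η * X + 1) * (2 / X ^ τ) ≤ 4 * X ^ (1 - τ / 2) := by
    have e : X * (2 / X ^ τ) = 2 * X ^ (1 - τ) := by
      rw [Real.rpow_sub hX0, Real.rpow_one]; field_simp
    have h1 : (η * X + 1) * (2 / X ^ τ) ≤ (2 * (η * X)) * (2 / X ^ τ) :=
      mul_le_mul_of_nonneg_right (by linarith) (by positivity)
    have h2 : (2 * (η * X)) * (2 / X ^ τ) = 4 * η * X ^ (1 - τ) := by
      rw [show 2 * (η * X) * (2 / X ^ τ) = 2 * η * (X * (2 / X ^ τ)) by ring, e]; ring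
    have h3 : 4 * η * X ^ (1 - τ) ≤ 4 * 1 * X ^ (1 - τ / 2) := by
      have h0 : 0 ≤ X ^ (1 - τ) := Real.rpow_nonneg hX0.le _
      exact mul_le_mul (by linarith) hXτmono h0 (by norm_num)
    linarith
  have hbr : (η * X + 1) * (2 / X ^ τ) + (5 * X ^ (1 - τ / 2) + 1) ≤ 10 * X ^ (1 - τ / 2) := by
    linarith
  have hE4Ale : E4A ≤ 60 * η * (X ^ 2 * X ^ (-(τ / 4))) := by
    have h2X : (2 : ℝ) ^ (4 / τ) * (X * X ^ (1 - τ / 2)) ≤ X ^ 2 * X ^ (-(τ / 4)) := by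
      have e : X ^ (τ / 4) * (X * X ^ (1 - τ / 2)) = X ^ 2 * X ^ (-(τ / 4)) := by
        rw [← rpow_two_sub hX0, show X * X ^ (1 - τ / 2) = X ^ (1 : ℝ) * X ^ (1 - τ / 2) by
          rw [Real.rpow_one], ← Real.rpow_add hX0, ← Real.rpow_add hX0]
        ring_nf
      rw [← e]
      exact mul_le_mul_of_nonneg_right h2pow (by positivity)
    have h1 : E4A ≤ (2 : ℝ) ^ (4 / τ) * (3 * (2 * (η * X)) * (10 * X ^ (1 - τ / 2))) := by
      rw [hE4A]
      refine mul_le_mul_of_nonneg_left ?_ (by positivity)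
      have ha : 3 * (η * X + 1) ≤ 3 * (2 * (η * X)) := by linarith
      have hb0 : 0 ≤ (η * X + 1) * (2 / X ^ τ) + (5 * X ^ (1 - τ / 2) + 1) := by positivity
      exact mul_le_mul ha hbr hb0 (by positivity)
    calc E4A ≤ (2 : ℝ) ^ (4 / τ) * (3 * (2 * (η * X)) * (10 * X ^ (1 - τ / 2))) := h1
      _ = 60 * η * ((2 : ℝ) ^ (4 / τ) * (X * X ^ (1 - τ / 2))) := by ring
      _ ≤ 60 * η * (X ^ 2 * X ^ (-(τ / 4))) := mul_le_mul_of_nonneg_left h2X (by positivity)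
  have hNB2 : NB ≤ 2 * L := hNB.trans (by linarith)
  have hT0 : 0 ≤ τ * η ^ 2 * X ^ 2 / L := by positivity
  have hT1 : NB * E4A ≤ 120 * (τ * η ^ 2 * X ^ 2 / L) := by
    have h1 : NB * E4A ≤ (2 * L) * (60 * η * (X ^ 2 * X ^ (-(τ / 4)))) :=
      mul_le_mul hNB2 hE4Ale hE4A0 (by positivity)
    have h2 : (2 * L) * (60 * η * (X ^ 2 * X ^ (-(τ / 4)))) = (120 * η) * (X ^ 2 * X ^ (-(τ / 4)) * L ^ 1) := by
      ring
    have h3 : (120 * η) * (X ^ 2 * X ^ (-(τ / 4)) * L ^ 1) ≤ (120 * η) * (τ * η ^ 2 * X ^ 2 / L) :=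
      absorb_le hX1.le hL1 (by positivity) (by linarith) (by norm_num) habs'
    have h4 : (120 * η) * (τ * η ^ 2 * X ^ 2 / L) ≤ 120 * (τ * η ^ 2 * X ^ 2 / L) := by
      have : 120 * η ≤ 120 := by linarith
      exact mul_le_mul_of_nonneg_right this hT0
    linarith
  have hT3 : 70 * (1 / τ + 1) * L * (C₇' * X ^ (2 - τ / 5)) ≤ 140 * C₇' * (τ * η ^ 2 * X ^ 2 / L) := by
    have h0 : 0 ≤ L * (C₇' * X ^ (2 - τ / 5)) := by positivity
    have h1 : 70 * (1 / τ + 1) * L * (C₇' * X ^ (2 - τ / 5)) ≤ 70 * (2 * L) * L * (C₇' * X ^ (2 - τ / 5)) := by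
      have : 70 * (1 / τ + 1) ≤ 70 * (2 * L) := by linarith
      calc 70 * (1 / τ + 1) * L * (C₇' * X ^ (2 - τ / 5)) = 70 * (1 / τ + 1) * (L * (C₇' * X ^ (2 - τ / 5))) := by ring
        _ ≤ 70 * (2 * L) * (L * (C₇' * X ^ (2 - τ / 5))) := mul_le_mul_of_nonneg_right this h0
        _ = _ := by ring
    have h2 : 70 * (2 * L) * L * (C₇' * X ^ (2 - τ / 5)) = (140 * C₇') * (X ^ 2 * X ^ (-(τ / 5)) * L ^ 2) := by
      rw [rpow_two_sub hX0]; ring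
    have h3 : (140 * C₇') * (X ^ 2 * X ^ (-(τ / 5)) * L ^ 2) ≤ (140 * C₇') * (τ * η ^ 2 * X ^ 2 / L) :=
      absorb_le hX1.le hL1 (by positivity) le_rfl (by norm_num) habs'
    linarith
  have hT2 : C₇' * (η ^ 2 * X ^ 2 / (τ * L)) * ((1600 + 700 * C₁) * τ ^ 2) =
      C₇' * (1600 + 700 * C₁) * (τ * η ^ 2 * X ^ 2 / L) := by
    field_simp
  rw [hT2]
  have hfin : 120 * (τ * η ^ 2 * X ^ 2 / L) + C₇' * (1600 + 700 * C₁) * (τ * η ^ 2 * X ^ 2 / L) +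
      140 * C₇' * (τ * η ^ 2 * X ^ 2 / L) =
      (C₇' * (1600 + 700 * C₁) + 140 * C₇' + 120) * τ * (η ^ 2 * X ^ 2 / L) := by ring
  linarith

set_option maxHeartbeats 400000 in
/-- **The `U`-part of Lemma 3.7 for `𝒜^(K)`, summed over `n`**: from the corrected Lemma 7.1,
`∑_{1 ≤ n ≤ n₀} |U₁^(n)(𝒜) − Û^(n)(𝒜)| ≤ C ξτ^{-4} η²X²/log X` for `X ≥ X₀` and `η` in (2.1)
(`U_sum_bound` with E1 = E3ii = 0 by Lemma 3.1 and E4 `≪ 2^{4/τ} η X^{2−τ/2} n₀`, absorbed together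
with the Lemma 7.1 error `X^{2−τ/5}` by (2.1), (2.5)). Also records `1 < X`, `0 < τ ≤ 1/40`.
[cite: HeathBrownActa2001, Lemma 3.7, §7 pp. 42–46] -/
theorem U_A_sum_bound (h71 : HeathBrown2001_lemma_7_1_normWeighted) {ϖ : ℝ} (hϖ0 : 0 < ϖ)
    (hϖ1 : ϖ < 1 / 5) :
    ∃ C X₀ : ℝ, ∀ X η : ℝ, X₀ ≤ X → Real.exp (-Real.log X ^ (1 / 3 : ℝ)) ≤ η → η ≤ 1 →
      1 < X ∧ 0 < hbTau ϖ X ∧ hbTau ϖ X ≤ 1 / 40 ∧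
      ∑ n ∈ Icc 1 (chainBound (hbTau ϖ X)),
          |(U1piece (boxPairs X η) pairIdeal X (hbTau ϖ X) n : ℝ) -
              Uhat X (hbTau ϖ X) (boxPairs X η) pairIdeal n| ≤
        C * (hbXi (hbTau ϖ X) / hbTau ϖ X ^ 4) * (η ^ 2 * X ^ 2 / Real.log X) := by
  classical
  obtain ⟨C₇, X₇, h7⟩ := h71 ϖ hϖ0 hϖ1
  obtain ⟨C₁, hC₁, hwin⟩ := exists_sum_normWt_window_le
  have hϖ1' : ϖ ≤ 1 := by linarith
  set C₇' : ℝ := max C₇ 1 with hC₇'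
  have hC₇'0 : 0 ≤ C₇' := le_trans zero_le_one (le_max_right _ _)
  have hCC : C₇ ≤ C₇' := le_max_left _ _
  have hcpos : 0 < min (1 / 40 : ℝ) (1 / (2 * C₁ + 1)) := lt_min (by norm_num) (by positivity)
  obtain ⟨X₁, hX₁⟩ := Filter.eventually_atTop.mp
    ((eventually_upperBound_params hϖ0 hϖ1' one_pos 3).and
      ((eventually_le_hbTau_mul_log hϖ1' 4).and
        ((eventually_hbTau_pow_mul_log hϖ0 hϖ1' 5 12 hcpos).and
          (eventually_ge_atTop (max X₇ ((2 : ℝ) ^ 15))))))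
  refine ⟨C₇' * (1600 + 700 * C₁) + 140 * C₇' + 120, X₁, fun X η hX hη hη1 => ?_⟩
  obtain ⟨⟨-, hτ0, hτ8, hlogτ, habs⟩, hτL4, ⟨h12, hτc⟩, hXmax⟩ := hX₁ X hX
  set τ := hbTau ϖ X with hτdef
  have hX15 : (2 : ℝ) ^ 15 ≤ X := le_trans (le_max_right _ _) hXmax
  have hX7 : X₇ ≤ X := le_trans (le_max_left _ _) hXmax
  have hX1 : 1 < X := lt_of_lt_of_le (by norm_num) hX15
  have hX0 : 0 < X := by linarith
  have hX24 : (24 : ℝ) ≤ X := le_trans (by norm_num) hX15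
  set L := Real.log X with hL
  have hL10 : 10 ≤ L := ten_le_log hX15
  have hL1 : 1 ≤ L := by linarith
  have hL0 : 0 < L := by linarith
  have hη0 : 0 < η := lt_of_lt_of_le (Real.exp_pos _) hη
  have hτ1 : τ ≤ 1 := by linarith
  have hτ40 : τ ≤ 1 / 40 := hτc.trans (min_le_left _ _)
  -- `2C₁τ⁴ ≤ 1`
  have hC₁τ : 2 * C₁ * τ ^ 4 ≤ 1 := by
    have h1 : τ ≤ 1 / (2 * C₁ + 1) := hτc.trans (min_le_right _ _)
    have h2 : τ ^ 4 ≤ τ := pow_le_of_le_one hτ0.le hτ1 (by norm_num)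
    have h3 : 2 * C₁ * τ ≤ 2 * C₁ * (1 / (2 * C₁ + 1)) := mul_le_mul_of_nonneg_left h1 (by positivity)
    have h4 : 2 * C₁ * (1 / (2 * C₁ + 1)) ≤ 1 := by
      rw [mul_one_div, div_le_one (by positivity)]; linarith
    have h5 : 2 * C₁ * τ ^ 4 ≤ 2 * C₁ * τ := mul_le_mul_of_nonneg_left h2 (by positivity)
    linarith
  -- `(log X)^{-1} ≤ τ⁵`, `τ^{-1} ≤ log X`
  have hLτ : 1 / L ≤ τ ^ 5 := by rw [div_le_iff₀ hL0]; linarith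
  have hτinvL : 1 / τ ≤ L := by
    rw [div_le_iff₀ hτ0]
    have := mul_le_mul_of_nonneg_left hlogτ hL0.le
    rw [mul_inv_cancel₀ hL0.ne'] at this
    linarith
  -- `X^τ ≥ e⁴ ≥ 5`, `24 < X^{3τ}`
  have he2 : (2 : ℝ) < Real.exp 1 := by have := Real.exp_one_gt_d9; linarith
  have hXτe : Real.exp 4 ≤ X ^ τ := by
    rw [Real.rpow_def_of_pos hX0, ← hL]
    exact Real.exp_le_exp.mpr (by nlinarith)
  have he4 : (16 : ℝ) ≤ Real.exp 4 := by
    have h3 : Real.exp 4 = Real.exp 1 ^ 4 := by rw [← Real.exp_nat_mul]; norm_num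
    rw [h3]
    calc (16 : ℝ) = 2 ^ 4 := by norm_num
      _ ≤ Real.exp 1 ^ 4 := pow_le_pow_left₀ (by norm_num) he2.le 4
  have hXτ5 : 5 ≤ X ^ τ := by linarith
  have hXτ4 : 4 ≤ X ^ τ := by linarith
  have hCN : (24 : ℝ) < X ^ (3 * τ) := by
    have h1 : Real.exp 12 ≤ X ^ (3 * τ) := by
      rw [Real.rpow_def_of_pos hX0, ← hL]
      exact Real.exp_le_exp.mpr (by nlinarith)
    have h2 : (24 : ℝ) < Real.exp 12 := by
      have h3 : Real.exp 12 = Real.exp 1 ^ 12 := by rw [← Real.exp_nat_mul]; norm_num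
      rw [h3]
      calc (24 : ℝ) < 2 ^ 12 := by norm_num
        _ ≤ Real.exp 1 ^ 12 := pow_le_pow_left₀ (by norm_num) he2.le 12
    linarith
  -- `2X^τ ≤ X^{1/2}`
  have hXτ2 : 2 * X ^ τ ≤ X ^ (1 / 2 : ℝ) := by
    have h1 : X ^ (1 / 2 : ℝ) = X ^ τ * X ^ (1 / 2 - τ) := by
      rw [← Real.rpow_add hX0]; ring_nf
    have h2 : (2 : ℝ) ≤ X ^ (1 / 2 - τ) := by
      have h3 : (16 : ℝ) ^ (1 / 4 : ℝ) = 2 := by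
        rw [show (16 : ℝ) = 2 ^ (4 : ℝ) by norm_num, ← Real.rpow_mul (by norm_num)]; norm_num
      calc (2 : ℝ) = 16 ^ (1 / 4 : ℝ) := h3.symm
        _ ≤ X ^ (1 / 4 : ℝ) := Real.rpow_le_rpow (by norm_num) (by linarith) (by norm_num)
        _ ≤ X ^ (1 / 2 - τ) := Real.rpow_le_rpow_of_exponent_le hX1.le (by linarith)
    rw [h1]
    have h0 : 0 < X ^ τ := Real.rpow_pos_of_pos hX0 τ
    nlinarith
  -- `2^{4/τ} ≤ X^{τ/4}`
  have h2pow : (2 : ℝ) ^ (4 / τ) ≤ X ^ (τ / 4) := by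
    have hτ2L : 12 ≤ τ ^ 2 * L := by
      have : τ ^ 5 ≤ τ ^ 2 := pow_le_pow_of_le_one hτ0.le hτ1 (by norm_num)
      exact h12.trans (mul_le_mul_of_nonneg_right this hL0.le)
    rw [Real.rpow_def_of_pos two_pos, Real.rpow_def_of_pos hX0, ← hL]
    refine Real.exp_le_exp.mpr ?_
    rw [show Real.log 2 * (4 / τ) = (16 * Real.log 2) / (4 * τ) by field_simp; ring,
      div_le_iff₀ (by positivity)]
    have hl2 := Real.log_two_lt_d9
    nlinarith
  -- members of `𝒜^(K)`
  have hE : ∀ xy ∈ boxPairs X η, pairIdeal xy ≠ ⊥ ∧ (Ideal.absNorm (pairIdeal xy) : ℝ) ≤ 24 * X ^ 3 :=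
    fun xy hxy => ⟨pairIdeal_ne_bot_of_mem_boxPairs hX0.le xy hxy, (absNorm_pairIdeal_bounds hX0 hη1 hxy).2⟩
  -- Lemma 7.1 for `𝒜`
  have h7A : ∀ (N z : ℝ) (𝒬 : Finset ℕ), X ^ τ ≤ z → 0 < N → N ≤ X ^ (2 - 2 * τ) →
      (∀ q ∈ 𝒬, Squarefree q ∧ N < q ∧ (q : ℝ) ≤ 2 * N) →
      ∑ Q ∈ normIn 𝒬, (famSifted (boxPairs X η) pairIdeal Q z : ℝ) ≤
        C₇' * (η ^ 2 * X ^ 2 / Real.log (min z (X ^ (2 - τ) / N)) *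
          ∑ Q ∈ normIn 𝒬, ((Ideal.absNorm Q : ℕ) : ℝ)⁻¹ + X ^ (2 - τ / 5)) := by
    intro N z 𝒬 hz hN hNX h𝒬
    have h := (h7 X η hX7 hη hη1 N z 𝒬 hz hN hNX h𝒬).1
    simp_rw [siftedA_eq_famSifted] at h
    refine h.trans (mul_le_mul_of_nonneg_right hCC ?_)
    have hlogmin : 0 ≤ Real.log (min z (X ^ (2 - τ) / N)) := by
      refine Real.log_nonneg ?_
      have hz1 : 1 ≤ z := le_trans (Real.one_le_rpow hX1.le hτ0.le) hz
      have h2 : 1 ≤ X ^ (2 - τ) / N := by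
        rw [le_div_iff₀ hN, one_mul]
        exact hNX.trans (Real.rpow_le_rpow_of_exponent_le hX1.le (by linarith))
      exact le_min hz1 h2
    have : 0 ≤ ∑ Q ∈ normIn 𝒬, ((Ideal.absNorm Q : ℕ) : ℝ)⁻¹ := sum_nonneg fun _ _ => by positivity
    positivity
  have hN : ((chainBound τ : ℕ) : ℝ) ≤ 1 / τ + 1 := by
    rw [chainBound]; push_cast
    linarith [Nat.floor_le (by positivity : (0 : ℝ) ≤ 1 / τ)]
  have hsum := U_sum_bound (boxPairs X η) pairIdeal hC₁ hwin hX15 hτ0 hτ40 hXτ4 hXτ2 hCN hE hC₇'0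
    (M := η ^ 2 * X ^ 2) (by positivity) (Err := X ^ (2 - τ / 5)) (by positivity) h7A hLτ hC₁τ hN
  refine ⟨hX1, hτ0, hτ40, hsum.trans ?_⟩
  clear hsum h7A h7 hE hwin
  have hscale : hbXi τ / τ ^ 4 = τ := hbXi_div_pow_four hτ0.ne'
  rw [hscale]
  have hXexp : Real.exp L = X := by rw [hL, Real.exp_log hX0]
  have hηX1 : 1 ≤ η * X := by
    have hL3 : L ^ (1 / 3 : ℝ) ≤ L := by
      calc L ^ (1 / 3 : ℝ) ≤ L ^ (1 : ℝ) := Real.rpow_le_rpow_of_exponent_le hL1 (by norm_num)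
        _ = L := Real.rpow_one L
    calc (1 : ℝ) = Real.exp 0 := Real.exp_zero.symm
      _ ≤ Real.exp (-L ^ (1 / 3 : ℝ) + L) := Real.exp_le_exp.mpr (by linarith)
      _ = Real.exp (-L ^ (1 / 3 : ℝ)) * Real.exp L := Real.exp_add _ _
      _ ≤ η * X := by
          rw [hXexp]
          exact mul_le_mul_of_nonneg_right hη hX0.le
  have hη2 : Real.exp (-2 * L ^ (1 / 3 : ℝ)) ≤ η ^ 2 := by
    have : Real.exp (-2 * L ^ (1 / 3 : ℝ)) = Real.exp (-L ^ (1 / 3 : ℝ)) ^ 2 := by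
      rw [← Real.exp_nat_mul]; ring_nf
    rw [this]
    exact pow_le_pow_left₀ (Real.exp_pos _).le hη 2
  have habs' : X ^ (-τ / 5) * L ^ 3 ≤ τ * η ^ 2 / L := by
    rw [one_mul] at habs
    refine habs.trans ?_
    exact div_le_div_of_nonneg_right (mul_le_mul_of_nonneg_left hη2 hτ0.le) hL0.le
  calc _ ≤ ∑ n ∈ Icc 1 (chainBound τ), (2 : ℝ) ^ (4 / τ) *
          (3 * (η * X + 1) * ((η * X + 1) * (2 / X ^ τ) + (5 * X ^ (1 - τ / 2) + 1))) +
        C₇' * (η ^ 2 * X ^ 2 / (τ * L)) * ((1600 + 700 * C₁) * τ ^ 2) +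
        70 * (1 / τ + 1) * L * (C₇' * X ^ (2 - τ / 5)) := by
        gcongr with n hn
        rw [E1_A_eq_zero, E3ii_A_eq_zero hX1 hτ0 hτ1, zero_add, zero_add]
        exact E4_A_le hX24 hτ0 hτ1 hη0 hη1 hXτ5 n
    _ = (chainBound τ : ℝ) * ((2 : ℝ) ^ (4 / τ) *
          (3 * (η * X + 1) * ((η * X + 1) * (2 / X ^ τ) + (5 * X ^ (1 - τ / 2) + 1)))) +
        C₇' * (η ^ 2 * X ^ 2 / (τ * L)) * ((1600 + 700 * C₁) * τ ^ 2) +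
        70 * (1 / τ + 1) * L * (C₇' * X ^ (2 - τ / 5)) := by
        rw [sum_const, Nat.card_Icc, Nat.add_sub_cancel, nsmul_eq_mul]
    _ ≤ (C₇' * (1600 + 700 * C₁) + 140 * C₇' + 120) * τ * (η ^ 2 * X ^ 2 / L) :=
        A_final_absorb hX1 hL1 hτ0 hτ1 hη0 hη1 hC₇'0 hC₁ hηX1 hXτ5 h2pow hτinvL hN habs'

/-- **Lemma 3.7, the three `U`-bounds for `𝒜^(K)`** from the corrected Lemma 7.1:
`∑_{3 ≤ n ≤ n₀} |U^(n) − Û^(n)|`, `|U₁^(1) − Û^(1)|`, `|U₁^(2) − Û^(2)|` are each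
`≤ C ξτ^{-4} η²X²/log X` for `X ≥ X₀`, `η` in (2.1) (`U^(n) = U₁^(n)` for `n ≥ 3`, p. 13).
[cite: HeathBrownActa2001, Lemma 3.7] -/
theorem U_A_bounds (h71 : HeathBrown2001_lemma_7_1_normWeighted) {ϖ : ℝ} (hϖ0 : 0 < ϖ)
    (hϖ1 : ϖ < 1 / 5) :
    ∃ C X₀ : ℝ, ∀ X η : ℝ, X₀ ≤ X → Real.exp (-Real.log X ^ (1 / 3 : ℝ)) ≤ η → η ≤ 1 →
      (∑ n ∈ Icc 3 (chainBound (hbTau ϖ X)),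
          |(Upiece (boxPairs X η) pairIdeal X (hbTau ϖ X) n : ℝ) -
              Uhat X (hbTau ϖ X) (boxPairs X η) pairIdeal n| ≤
        C * (hbXi (hbTau ϖ X) / hbTau ϖ X ^ 4) * (η ^ 2 * X ^ 2 / Real.log X)) ∧
      (|(U1piece (boxPairs X η) pairIdeal X (hbTau ϖ X) 1 : ℝ) -
            Uhat X (hbTau ϖ X) (boxPairs X η) pairIdeal 1| ≤
        C * (hbXi (hbTau ϖ X) / hbTau ϖ X ^ 4) * (η ^ 2 * X ^ 2 / Real.log X)) ∧
      (|(U1piece (boxPairs X η) pairIdeal X (hbTau ϖ X) 2 : ℝ) -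
            Uhat X (hbTau ϖ X) (boxPairs X η) pairIdeal 2| ≤
        C * (hbXi (hbTau ϖ X) / hbTau ϖ X ^ 4) * (η ^ 2 * X ^ 2 / Real.log X)) := by
  obtain ⟨C, X₀, h⟩ := U_A_sum_bound h71 hϖ0 hϖ1
  refine ⟨C, X₀, fun X η hX hη hη1 => ?_⟩
  obtain ⟨hX1, hτ0, hτ40, hsum⟩ := h X η hX hη hη1
  set τ := hbTau ϖ X with hτ
  set N := chainBound τ with hN
  have hnonneg : ∀ n ∈ Icc 1 N, 0 ≤ |(U1piece (boxPairs X η) pairIdeal X τ n : ℝ) -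
      Uhat X τ (boxPairs X η) pairIdeal n| := fun _ _ => abs_nonneg _
  have hN2 : 2 ≤ N := by
    rw [hN, chainBound]
    have : 1 ≤ ⌊1 / τ⌋₊ := Nat.le_floor (by
      rw [Nat.cast_one, le_div_iff₀ hτ0]; linarith)
    omega
  refine ⟨?_, ?_, ?_⟩
  · calc ∑ n ∈ Icc 3 N, |(Upiece (boxPairs X η) pairIdeal X τ n : ℝ) - Uhat X τ (boxPairs X η) pairIdeal n|
        = ∑ n ∈ Icc 3 N, |(U1piece (boxPairs X η) pairIdeal X τ n : ℝ) -
            Uhat X τ (boxPairs X η) pairIdeal n| := by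
          refine sum_congr rfl fun n hn => ?_
          rw [Upiece_eq_U1piece (boxPairs X η) pairIdeal hX1 hτ0 (by linarith) (mem_Icc.mp hn).1]
      _ ≤ ∑ n ∈ Icc 1 N, |(U1piece (boxPairs X η) pairIdeal X τ n : ℝ) -
            Uhat X τ (boxPairs X η) pairIdeal n| :=
          sum_le_sum_of_subset_of_nonneg (fun n hn => by
            rw [mem_Icc] at hn ⊢; omega) fun n _ _ => abs_nonneg _
      _ ≤ _ := hsum
  · have h1 : 1 ∈ Icc 1 N := by rw [mem_Icc]; omega
    exact (single_le_sum hnonneg h1).trans hsum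
  · have h2 : 2 ∈ Icc 1 N := by rw [mem_Icc]; omega
    exact (single_le_sum hnonneg h2).trans hsum

end FamilyA

end Literature.NumberTheory.Sieve.CubicSieve

end
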